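import Summits.QuantumFields.YangMills.Theorems.SwapVirialDeficitQuantitativeLaplaceHessianFloor
import Summits.QuantumFields.YangMills.Theorems.SwapVirialDeficitBlowUpGnomonicLetterFloors
import Summits.QuantumFields.YangMills.Theorems.SwapVirialDeficitBlowUpGnomonicAngleChartDefs
import Summits.QuantumFields.YangMills.Theorems.SwapVirialDeficitBlowUpGnomonicBaseFlat
import Summits.QuantumFields.YangMills.Theorems.SwapVirialDeficitSectorLaplaceDefs
import Summits.QuantumFields.YangMills.Theorems.SwapVirialDeficitGnomonicDeficitSmooth
import HarnessLib

/-!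
# Route `SwapVirialDeficit` (YangMills): THE STRUCTURED FLOOR OF THE FIBRE HESSIAN AT THE FLAT BASE POINT — one soft pair, the relative tilt pinned at `O(|p|²)`
# (cell ym-idea-1, skeleton ➎; the FLOOR half of w2 g60's memo3 Hessian sandwich for `stub_core_tip` (memo3 §§2, 6, 7);
# free-hands support of ⟨stmt-QuantumFields-24197⟩ `SwapVirialDeficit.SwapGluedStiffness`)

At the hub `angUnit θ` (every `θ`; `c = cos θ`, `s = sin θ`), principal signs, base point `p = (x₀, y₀)` and fibre vector `y` with blocks `(u, v, z, η_F)`: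
★★★ `fibQ_angUnit_ge_floorForm` —
`Q_{angUnit θ,ε,p}(y) ≥ ¼·[16c²s²|u|²/(7200L⁶(1+x₀²)) + 4s²|v|²/(1800L⁶(1+y₀²)) + 4((u₁y₀ − x₀v₁)² + (x₀v₀ − u₀y₀)²)/(1800L⁶(1+x₀²)(1+y₀²)) + |z|²/(1800L⁶)]`.
The third term (w3's ✓`gnoDeficit_floor_yAxial`: the RELATIVE TILT of the two free leaders) does not vanish as `s → 0`: with the hub terms the `(u,v)` block is `M ⊗ I₂`,
`det M = a_u a_v + c_r(a_u x₀² + a_v y₀²) ≍ s²` — ONE soft pair.  Proof: the four pointwise letter floors (✓`gnoDeficit_floor_hubPolar/_yPerp/_yAxial/_z`) dominate,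
for `|t| < 1/(2(1+‖y‖))`, an explicit polynomial that is quadratic along the fibre line and touches `F̂` at the flat base point;
✓`hessianForm_le_of_le_near` + ✓`hessianForm_eq_of_sq_line`.

HONEST LABEL: calculus∕algebra on landed floors; `stub_core_tip` and the other stubs, ⟨24197⟩ ∕ ⟨24194⟩ OPEN; own crux ⟨22884⟩ `LargeFieldMassRefinementTail` OPEN (blocked-on ⟨19935⟩);
the Yang–Mills mass gap is NOT proved; no summit is proved by a line.  THEOREMS ONLY (0 `def`, 0 `sorry`), standard axioms.  Width seat ym-line-sfw-p2-w2 g60 (cell ym-idea-1,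
free hands), `--supports stmt-QuantumFields-24197`.  References: [cite: Luscher1983, §2]; [folklore].
-/

set_option autoImplicit false

noncomputable section

open Quaternion Set
open scoped Quaternion BigOperators
open Literature.MathematicalPhysics.QuantumLattice
open Literature.MathematicalPhysics.QuantumFieldTheory hiding SU2

namespace Summit.QuantumFields.YangMills.Theorems.SwapVirialDeficit.BlowUpRing

open Summit.QuantumFields.YangMills.Theorems.FemtoTransferGap
open Summit.QuantumFields.YangMills.Theorems.FemtoTransferGap.TT
open Summit.QuantumFields.YangMills.Theorems.SwapVirialDeficit.SectorLaplace
open Summit.QuantumFields.YangMills.Theorems.SwapVirialDeficit.Gnomonic (contDiff_gnoDeficit)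
open Summit.QuantumFields.YangMills.Theorems.QuantitativeLaplace (hessianForm_le_of_le_near hessianForm_eq_of_sq_line)

variable {L : ℕ} [NeZero L]

/-- The fibre line through the base point in coordinates: `gnoBase p + t·ξ(y) = ((x₀, t u₀, t u₁), (y₀, t v₀, t v₁), t z, t η_F)`. [folklore] -/
theorem gnoBase_add_smul_gnoFibreEmb_apply (p : ℝ × ℝ) (t : ℝ) (y : GnoFibre L) :
    (gnoBase p.1 p.2 + t • gnoFibreEmb y).1.1 0 = p.1 ∧ (gnoBase p.1 p.2 + t • gnoFibreEmb y).1.1 1 = t * y (Sum.inl (Sum.inl 0)) ∧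
    (gnoBase p.1 p.2 + t • gnoFibreEmb y).1.1 2 = t * y (Sum.inl (Sum.inl 1)) ∧
    (gnoBase p.1 p.2 + t • gnoFibreEmb y).1.2 0 = p.2 ∧ (gnoBase p.1 p.2 + t • gnoFibreEmb y).1.2 1 = t * y (Sum.inl (Sum.inr 0)) ∧
    (gnoBase p.1 p.2 + t • gnoFibreEmb y).1.2 2 = t * y (Sum.inl (Sum.inr 1)) ∧
    (∀ k, (gnoBase p.1 p.2 + t • gnoFibreEmb y).2.1 k = t * y (Sum.inr (Sum.inl k))) := by
  rw [← gnoFibreEquiv_apply_smul, gnoFibreEquiv_apply']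
  simp

set_option maxHeartbeats 800000 in
/-- ★★★ **THE STRUCTURED FLOOR OF THE FIBRE HESSIAN** at the flat base point, hub `angUnit θ` (every `θ`), principal signs (see the file header). [cite: Luscher1983, §2] -/
theorem fibQ_angUnit_ge_floorForm (θ : ℝ) (ε : GnoSign L) (hz : ε.2.1 = true) (hF : ε.2.2 = fun _ => true) (p : ℝ × ℝ) (y : GnoFibre L) :
    (1 / 4 : ℝ) * ((16 * Real.cos θ ^ 2 * Real.sin θ ^ 2 / ((7200 * (L : ℝ) ^ 6) * (1 + p.1 ^ 2))) * (y (Sum.inl (Sum.inl 0)) ^ 2 + y (Sum.inl (Sum.inl 1)) ^ 2) + (4 * Real.sin θ ^ 2 / ((1800 * (L : ℝ) ^ 6) * (1 + p.2 ^ 2))) * (y (Sum.inl (Sum.inr 0)) ^ 2 + y (Sum.inl (Sum.inr 1)) ^ 2) + (4 / ((1800 * (L : ℝ) ^ 6) * ((1 + p.1 ^ 2) * (1 + p.2 ^ 2)))) * ((y (Sum.inl (Sum.inl 1)) * p.2 - p.1 * y (Sum.inl (Sum.inr 1))) ^ 2 + (p.1 * y (Sum.inl (Sum.inr 0)) - y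 (Sum.inl (Sum.inl 0)) * p.2) ^ 2) + (1 / (1800 * (L : ℝ) ^ 6)) * (∑ k, y (Sum.inr (Sum.inl k)) ^ 2)) ≤ fibQ (angUnit θ) ε p y := by
  have hL : (0 : ℝ) < (L : ℝ) := Nat.cast_pos.2 (Nat.pos_of_ne_zero (NeZero.ne L))
  have ha : angUnit θ ≠ 0 := angUnit_ne_zero θ
  -- the quadratic minorant
  have hgc : ContDiff ℝ 2 (fun η : GnoCoord L => (1 / 8 : ℝ) * ((16 * Real.cos θ ^ 2 * Real.sin θ ^ 2 / ((7200 * (L : ℝ) ^ 6) * (1 + p.1 ^ 2))) * (η.1.1 1 ^ 2 + η.1.1 2 ^ 2) + (4 * Real.sin θ ^ 2 / ((1800 * (L : ℝ) ^ 6) * (1 + p.2 ^ 2))) * (η.1.2 1 ^ 2 + η.1.2 2 ^ 2) +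
      (4 / ((1800 * (L : ℝ) ^ 6) * ((1 + p.1 ^ 2) * (1 + p.2 ^ 2)))) * ((η.1.1 2 * p.2 - p.1 * η.1.2 2) ^ 2 + (p.1 * η.1.2 1 - η.1.1 1 * p.2) ^ 2) + (1 / (1800 * (L : ℝ) ^ 6)) * ∑ k, η.2.1 k ^ 2)) := by
    have h11 : ∀ k, ContDiff ℝ 2 fun η : GnoCoord L => η.1.1 k := fun k => (contDiff_apply ℝ ℝ k).comp (contDiff_fst.comp contDiff_fst)
    have h12 : ∀ k, ContDiff ℝ 2 fun η : GnoCoord L => η.1.2 k := fun k => (contDiff_apply ℝ ℝ k).comp (contDiff_snd.comp contDiff_fst)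
    have h21 : ∀ k, ContDiff ℝ 2 fun η : GnoCoord L => η.2.1 k := fun k => (contDiff_apply ℝ ℝ k).comp (contDiff_fst.comp contDiff_snd)
    refine contDiff_const.mul ((((contDiff_const.mul (((h11 1).pow 2).add ((h11 2).pow 2))).add (contDiff_const.mul (((h12 1).pow 2).add ((h12 2).pow 2)))).add
      (contDiff_const.mul (((((h11 2).mul contDiff_const).sub (contDiff_const.mul (h12 2))).pow 2).add
        (((contDiff_const.mul (h12 1)).sub ((h11 1).mul contDiff_const)).pow 2)))).add (contDiff_const.mul (ContDiff.sum fun k _ => (h21 k).pow 2)))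
  have hFc : ContDiff ℝ 2 (fun η : GnoCoord L => gnoDeficit z₀ (fun _ => 1) (angUnit θ) ε η) := contDiff_gnoDeficit (n := 2) z₀ (fun _ => 1) ha ε
  -- values along the line
  have hlineg : ∀ t : ℝ, (fun η : GnoCoord L => (1 / 8 : ℝ) * ((16 * Real.cos θ ^ 2 * Real.sin θ ^ 2 / ((7200 * (L : ℝ) ^ 6) * (1 + p.1 ^ 2))) * (η.1.1 1 ^ 2 + η.1.1 2 ^ 2) + (4 * Real.sin θ ^ 2 / ((1800 * (L : ℝ) ^ 6) * (1 + p.2 ^ 2))) * (η.1.2 1 ^ 2 + η.1.2 2 ^ 2) +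
      (4 / ((1800 * (L : ℝ) ^ 6) * ((1 + p.1 ^ 2) * (1 + p.2 ^ 2)))) * ((η.1.1 2 * p.2 - p.1 * η.1.2 2) ^ 2 + (p.1 * η.1.2 1 - η.1.1 1 * p.2) ^ 2) + (1 / (1800 * (L : ℝ) ^ 6)) * ∑ k, η.2.1 k ^ 2)) (gnoBase p.1 p.2 + t • gnoFibreEmb y) = (fun η : GnoCoord L => (1 / 8 : ℝ) * ((16 * Real.cos θ ^ 2 * Real.sin θ ^ 2 / ((7200 * (L : ℝ) ^ 6) * (1 + p.1 ^ 2))) * (η.1.1 1 ^ 2 + η.1.1 2 ^ 2) + (4 * Real.sin θ ^ 2 / ((1800 * (L : ℝ) ^ 6) * (1 + p.2 ^ 2))) * (η.1.2 1 ^ 2 + η.1.2 2 ^ 2) +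
      (4 / ((1800 * (L : ℝ) ^ 6) * ((1 + p.1 ^ 2) * (1 + p.2 ^ 2)))) * ((η.1.1 2 * p.2 - p.1 * η.1.2 2) ^ 2 + (p.1 * η.1.2 1 - η.1.1 1 * p.2) ^ 2) + (1 / (1800 * (L : ℝ) ^ 6)) * ∑ k, η.2.1 k ^ 2)) (gnoBase p.1 p.2) + (1 / 8 : ℝ) * ((16 * Real.cos θ ^ 2 * Real.sin θ ^ 2 / ((7200 * (L : ℝ) ^ 6) * (1 + p.1 ^ 2))) * (y (Sum.inl (Sum.inl 0)) ^ 2 + y (Sum.inl (Sum.inl 1)) ^ 2) + (4 * Real.sin θ ^ 2 / ((1800 * (L : ℝ) ^ 6) * (1 + p.2 ^ 2))) * (y (Sum.inl (Sum.inr 0)) ^ 2 + y (Sum.inl (Sum.inr 1)) ^ 2) + (4 / ((1800 * (L : ℝ) ^ 6) * ((1 + p.1 ^ 2) * (1 + p.2 ^ 2)))) * ((y (Sum.inl (Sum.inl 1)) * p.2 - p.1 * y (Sum.inl (Sum.inr 1))) ^ 2 + (p.1 * y (Sum.inl (Sum.inr 0)) - y (Sum.inl (Sum.inl 0)) * p.2)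 ^ 2) + (1 / (1800 * (L : ℝ) ^ 6)) * (∑ k, y (Sum.inr (Sum.inl k)) ^ 2)) * t ^ 2 := by
    intro t
    obtain ⟨e0, e1, e2, f0, f1, f2, ez⟩ := gnoBase_add_smul_gnoFibreEmb_apply p t y
    obtain ⟨e0', e1', e2', f0', f1', f2', ez'⟩ := gnoBase_add_smul_gnoFibreEmb_apply p 0 y
    simp only [zero_smul, add_zero, zero_mul] at e1' e2' f1' f2' ez'
    simp only [e1, e2, f1, f2, ez, e1', e2', f1', f2', ez']
    have hsum : ∑ k, (t * y (Sum.inr (Sum.inl k))) ^ 2 = t ^ 2 * ∑ k, y (Sum.inr (Sum.inl k)) ^ 2 := by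
      rw [Finset.mul_sum]; exact Finset.sum_congr rfl fun k _ => by ring
    rw [hsum]
    simp only [Fin.sum_univ_three]
    ring
  have hg0 : (fun η : GnoCoord L => (1 / 8 : ℝ) * ((16 * Real.cos θ ^ 2 * Real.sin θ ^ 2 / ((7200 * (L : ℝ) ^ 6) * (1 + p.1 ^ 2))) * (η.1.1 1 ^ 2 + η.1.1 2 ^ 2) + (4 * Real.sin θ ^ 2 / ((1800 * (L : ℝ) ^ 6) * (1 + p.2 ^ 2))) * (η.1.2 1 ^ 2 + η.1.2 2 ^ 2) +
      (4 / ((1800 * (L : ℝ) ^ 6) * ((1 + p.1 ^ 2) * (1 + p.2 ^ 2)))) * ((η.1.1 2 * p.2 - p.1 * η.1.2 2) ^ 2 + (p.1 * η.1.2 1 - η.1.1 1 * p.2) ^ 2) + (1 / (1800 * (L : ℝ) ^ 6)) * ∑ k, η.2.1 k ^ 2)) (gnoBase p.1 p.2) = 0 := by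
    obtain ⟨e0', e1', e2', f0', f1', f2', ez'⟩ := gnoBase_add_smul_gnoFibreEmb_apply p 0 y
    simp only [zero_smul, add_zero, zero_mul] at e1' e2' f1' f2' ez'
    simp only [e1', e2', f1', f2', ez']
    simp
  have hF0 : (fun η : GnoCoord L => gnoDeficit z₀ (fun _ => 1) (angUnit θ) ε η) (gnoBase p.1 p.2) = 0 := gnoDeficit_base_eq_zero ha ε hz hF p.1 p.2
  -- local domination along the line
  have hρ0 : (0 : ℝ) < 1 / (2 * (1 + ‖y‖)) := by positivity
  have hcoord : ∀ i, y i ^ 2 ≤ ‖y‖ ^ 2 := fun i => by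
    have h := PiLp.norm_apply_le y i
    rw [Real.norm_eq_abs] at h
    nlinarith [abs_nonneg (y i), sq_abs (y i)]
  have hle : ∀ t : ℝ, |t| < 1 / (2 * (1 + ‖y‖)) →
      (fun η : GnoCoord L => (1 / 8 : ℝ) * ((16 * Real.cos θ ^ 2 * Real.sin θ ^ 2 / ((7200 * (L : ℝ) ^ 6) * (1 + p.1 ^ 2))) * (η.1.1 1 ^ 2 + η.1.1 2 ^ 2) + (4 * Real.sin θ ^ 2 / ((1800 * (L : ℝ) ^ 6) * (1 + p.2 ^ 2))) * (η.1.2 1 ^ 2 + η.1.2 2 ^ 2) +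
      (4 / ((1800 * (L : ℝ) ^ 6) * ((1 + p.1 ^ 2) * (1 + p.2 ^ 2)))) * ((η.1.1 2 * p.2 - p.1 * η.1.2 2) ^ 2 + (p.1 * η.1.2 1 - η.1.1 1 * p.2) ^ 2) + (1 / (1800 * (L : ℝ) ^ 6)) * ∑ k, η.2.1 k ^ 2)) (gnoBase p.1 p.2 + t • gnoFibreEmb y) ≤ (fun η : GnoCoord L => gnoDeficit z₀ (fun _ => 1) (angUnit θ) ε η) (gnoBase p.1 p.2 + t • gnoFibreEmb y) := by
    intro t ht
    beta_reduce
    have hty : t ^ 2 * ‖y‖ ^ 2 ≤ 1 / 4 := by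
      have h1 : |t| * (2 * (1 + ‖y‖)) < 1 := by rwa [lt_div_iff₀ (by positivity : (0 : ℝ) < 2 * (1 + ‖y‖))] at ht
      have h2 : |t| * ‖y‖ ≤ 1 / 2 := by nlinarith [abs_nonneg t, norm_nonneg y]
      have h3 : 0 ≤ |t| * ‖y‖ := by positivity
      nlinarith [sq_abs t]
    have hty1 : ∀ i, t ^ 2 * y i ^ 2 ≤ 1 / 4 := fun i => le_trans (by nlinarith [hcoord i, sq_nonneg t]) hty
    obtain ⟨e0, e1, e2, f0, f1, f2, ez⟩ := gnoBase_add_smul_gnoFibreEmb_apply p t y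
    have hna : ‖angUnit θ‖ = 1 := norm_angUnit θ
    have hre : (angUnit θ).re = Real.cos θ := angUnit_re θ
    have him : ‖(angUnit θ).im‖ ^ 2 = Real.sin θ ^ 2 := by rw [norm_im_angUnit, sq_abs]
    have hFu := gnoDeficit_floor_hubPolar ha ε (gnoBase p.1 p.2 + t • gnoFibreEmb y)
    have hFv := gnoDeficit_floor_yPerp ha ε (gnoBase p.1 p.2 + t • gnoFibreEmb y)
    have hFr := gnoDeficit_floor_yAxial (angUnit θ) ε (gnoBase p.1 p.2 + t • gnoFibreEmb y)
    have hFz := gnoDeficit_floor_z ha ε (gnoBase p.1 p.2 + t • gnoFibreEmb y)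
    rw [hna, hre, e0, e1, e2, him, one_pow, one_pow, one_mul] at hFu
    rw [hna, f0, f1, f2, him, one_pow, one_mul] at hFv
    rw [e0, e1, e2, f0, f1, f2] at hFr
    simp only [ez] at hFz
    set Fv : ℝ := gnoDeficit z₀ (fun _ => 1) (angUnit θ) ε (gnoBase p.1 p.2 + t • gnoFibreEmb y) with hFvdef
    have hFnn : 0 ≤ Fv := gnoDeficit_nonneg z₀ (fun _ => (1 : SU2)) (angUnit θ) ε _
    clear_value Fv
    have hZS3 : (∑ k, y (Sum.inr (Sum.inl k)) ^ 2) = y (Sum.inr (Sum.inl 0)) ^ 2 + y (Sum.inr (Sum.inl 1)) ^ 2 + y (Sum.inr (Sum.inl 2)) ^ 2 := by rw [Fin.sum_univ_three]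
    have hsumU : (y (Sum.inl (Sum.inl 0)) ^ 2 + y (Sum.inl (Sum.inl 1)) ^ 2) ≤ ‖y‖ ^ 2 := by
      rw [EuclideanSpace.real_norm_sq_eq y, Fintype.sum_sum_type, Fintype.sum_sum_type, Fin.sum_univ_two]
      have h1 : 0 ≤ ∑ j : Fin 2, ‖y (Sum.inl (Sum.inr j))‖ ^ 2 := Finset.sum_nonneg fun j _ => sq_nonneg _
      have h2 : 0 ≤ ∑ j : Fin 3 ⊕ Fol L × Fin 3, ‖y (Sum.inr j)‖ ^ 2 := Finset.sum_nonneg fun j _ => sq_nonneg _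
      simp only [Real.norm_eq_abs, sq_abs] at h1 h2 ⊢
      linarith
    have hsumV : (y (Sum.inl (Sum.inr 0)) ^ 2 + y (Sum.inl (Sum.inr 1)) ^ 2) ≤ ‖y‖ ^ 2 := by
      rw [EuclideanSpace.real_norm_sq_eq y, Fintype.sum_sum_type, Fintype.sum_sum_type, Fin.sum_univ_two, Fin.sum_univ_two]
      have h1 : 0 ≤ ∑ j : Fin 3 ⊕ Fol L × Fin 3, ‖y (Sum.inr j)‖ ^ 2 := Finset.sum_nonneg fun j _ => sq_nonneg _
      simp only [Real.norm_eq_abs, sq_abs] at h1 ⊢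
      nlinarith [sq_nonneg (y (Sum.inl (Sum.inl 0))), sq_nonneg (y (Sum.inl (Sum.inl 1)))]
    have hu0 := hty1 (Sum.inl (Sum.inl 0)); have hu1 := hty1 (Sum.inl (Sum.inl 1))
    have hv0 := hty1 (Sum.inl (Sum.inr 0)); have hv1 := hty1 (Sum.inl (Sum.inr 1))
    have hz0 := hty1 (Sum.inr (Sum.inl 0)); have hz1 := hty1 (Sum.inr (Sum.inl 1)); have hz2 := hty1 (Sum.inr (Sum.inl 2))
    have hp1 := sq_nonneg p.1; have hp2 := sq_nonneg p.2
    have hl := hlineg t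
    have h0 := hg0
    beta_reduce at hl h0
    rw [hl, h0, zero_add]
    rw [hZS3] at *
    -- opaque real letters (keeps `ring`/`linarith` away from the `PiLp` coercions)
    generalize y (Sum.inl (Sum.inl 0)) = u0 at *
    generalize y (Sum.inl (Sum.inl 1)) = u1 at *
    generalize y (Sum.inl (Sum.inr 0)) = v0 at *
    generalize y (Sum.inl (Sum.inr 1)) = v1 at *
    generalize y (Sum.inr (Sum.inl 0)) = z0 at *
    generalize y (Sum.inr (Sum.inl 1)) = z1 at *
    generalize y (Sum.inr (Sum.inl 2)) = z2 at *
    -- the four shares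
    -- sizes along the line
    have eU : t ^ 2 * (u0 ^ 2 + u1 ^ 2) = t ^ 2 * u0 ^ 2 + t ^ 2 * u1 ^ 2 := by ring
    have eV : t ^ 2 * (v0 ^ 2 + v1 ^ 2) = t ^ 2 * v0 ^ 2 + t ^ 2 * v1 ^ 2 := by ring
    have hUt : t ^ 2 * (u0 ^ 2 + u1 ^ 2) ≤ 1 + p.1 ^ 2 := by rw [eU]; linarith only [hu0, hu1, hp1]
    have hVt : t ^ 2 * (v0 ^ 2 + v1 ^ 2) ≤ 1 + p.2 ^ 2 := by rw [eV]; linarith only [hv0, hv1, hp2]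
    have hUt4 : t ^ 2 * (u0 ^ 2 + u1 ^ 2) ≤ (1 + p.1 ^ 2) / 4 := by
      have h := mul_le_mul_of_nonneg_left hsumU (sq_nonneg t); linarith [hty, sq_nonneg p.1]
    have hVt4 : t ^ 2 * (v0 ^ 2 + v1 ^ 2) ≤ (1 + p.2 ^ 2) / 4 := by
      have h := mul_le_mul_of_nonneg_left hsumV (sq_nonneg t); linarith [hty, sq_nonneg p.2]
    have hZt : t ^ 2 * (z0 ^ 2 + z1 ^ 2 + z2 ^ 2) ≤ 1 := by
      rw [show t ^ 2 * (z0 ^ 2 + z1 ^ 2 + z2 ^ 2) = t ^ 2 * z0 ^ 2 + t ^ 2 * z1 ^ 2 + t ^ 2 * z2 ^ 2 by ring]; linarith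
    have hUU0 : 0 ≤ (u0 ^ 2 + u1 ^ 2) := by positivity
    have hVV0 : 0 ≤ (v0 ^ 2 + v1 ^ 2) := by positivity
    have hNN0 : 0 ≤ ((u1 * p.2 - p.1 * v1) ^ 2 + (p.1 * v0 - u0 * p.2) ^ 2) := by positivity
    have hZS0 : 0 ≤ (z0 ^ 2 + z1 ^ 2 + z2 ^ 2) := by positivity
    have hx1 : 0 < 1 + p.1 ^ 2 := by positivity
    have hy1 : 0 < 1 + p.2 ^ 2 := by positivity
    -- (u) share
    have hDu : 0 < 1 + (p.1 ^ 2 + (t * u0) ^ 2 + (t * u1) ^ 2) := by positivity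
    have h1u := (div_le_iff₀ hDu).1 hFu
    have ku : (1 / 8 : ℝ) * ((16 * Real.cos θ ^ 2 * Real.sin θ ^ 2 / ((7200 * (L : ℝ) ^ 6) * (1 + p.1 ^ 2))) * (u0 ^ 2 + u1 ^ 2)) * t ^ 2 ≤ Fv / 4 := by
      rw [show (1 / 8 : ℝ) * ((16 * Real.cos θ ^ 2 * Real.sin θ ^ 2 / ((7200 * (L : ℝ) ^ 6) * (1 + p.1 ^ 2))) * (u0 ^ 2 + u1 ^ 2)) * t ^ 2 =
          (1 / 8 : ℝ) * (16 * Real.cos θ ^ 2 * Real.sin θ ^ 2 * (t ^ 2 * (u0 ^ 2 + u1 ^ 2))) / ((7200 * (L : ℝ) ^ 6) * (1 + p.1 ^ 2)) by ring, div_le_iff₀ (by positivity)]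
      have hcs : 0 ≤ 16 * Real.cos θ ^ 2 * Real.sin θ ^ 2 := by positivity
      have hmono : 7200 * (L : ℝ) ^ 6 * Fv * (1 + (p.1 ^ 2 + (t * u0) ^ 2 + (t * u1) ^ 2)) ≤ 7200 * (L : ℝ) ^ 6 * Fv * (2 * (1 + p.1 ^ 2)) :=
        mul_le_mul_of_nonneg_left (by
          have ee : (t * u0) ^ 2 + (t * u1) ^ 2 = t ^ 2 * (u0 ^ 2 + u1 ^ 2) := by ring
          linarith only [hUt, ee]) (mul_nonneg (by positivity) hFnn)
      have h1u' : 16 * Real.cos θ ^ 2 * Real.sin θ ^ 2 * (t ^ 2 * (u0 ^ 2 + u1 ^ 2)) ≤ 7200 * (L : ℝ) ^ 6 * Fv * (1 + (p.1 ^ 2 + (t * u0) ^ 2 + (t * u1) ^ 2)) := by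
        have ee : (t * u0) ^ 2 + (t * u1) ^ 2 = t ^ 2 * (u0 ^ 2 + u1 ^ 2) := by ring
        rw [ee] at h1u; exact h1u
      linarith only [h1u', hmono]
    -- (v) share
    have hDv : 0 < 1 + (p.2 ^ 2 + (t * v0) ^ 2 + (t * v1) ^ 2) := by positivity
    have h1v := (div_le_iff₀ hDv).1 hFv
    have kv : (1 / 8 : ℝ) * ((4 * Real.sin θ ^ 2 / ((1800 * (L : ℝ) ^ 6) * (1 + p.2 ^ 2))) * (v0 ^ 2 + v1 ^ 2)) * t ^ 2 ≤ Fv / 4 := by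
      rw [show (1 / 8 : ℝ) * ((4 * Real.sin θ ^ 2 / ((1800 * (L : ℝ) ^ 6) * (1 + p.2 ^ 2))) * (v0 ^ 2 + v1 ^ 2)) * t ^ 2 =
          (1 / 8 : ℝ) * (4 * Real.sin θ ^ 2 * (t ^ 2 * (v0 ^ 2 + v1 ^ 2))) / ((1800 * (L : ℝ) ^ 6) * (1 + p.2 ^ 2)) by ring, div_le_iff₀ (by positivity)]
      have hmono : 1800 * (L : ℝ) ^ 6 * Fv * (1 + (p.2 ^ 2 + (t * v0) ^ 2 + (t * v1) ^ 2)) ≤ 1800 * (L : ℝ) ^ 6 * Fv * (2 * (1 + p.2 ^ 2)) :=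
        mul_le_mul_of_nonneg_left (by
          have ee : (t * v0) ^ 2 + (t * v1) ^ 2 = t ^ 2 * (v0 ^ 2 + v1 ^ 2) := by ring
          linarith only [hVt, ee]) (mul_nonneg (by positivity) hFnn)
      have h1v' : 4 * Real.sin θ ^ 2 * (t ^ 2 * (v0 ^ 2 + v1 ^ 2)) ≤ 1800 * (L : ℝ) ^ 6 * Fv * (1 + (p.2 ^ 2 + (t * v0) ^ 2 + (t * v1) ^ 2)) := by
        have ee : (t * v0) ^ 2 + (t * v1) ^ 2 = t ^ 2 * (v0 ^ 2 + v1 ^ 2) := by ring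
        rw [ee] at h1v; exact h1v
      linarith only [h1v', hmono]
    -- (r) share
    have hDr : 0 < (1 + (p.1 ^ 2 + (t * u0) ^ 2 + (t * u1) ^ 2)) * (1 + (p.2 ^ 2 + (t * v0) ^ 2 + (t * v1) ^ 2)) := mul_pos hDu hDv
    have h1r := (div_le_iff₀ hDr).1 hFr
    have kr : (1 / 8 : ℝ) * ((4 / ((1800 * (L : ℝ) ^ 6) * ((1 + p.1 ^ 2) * (1 + p.2 ^ 2)))) * ((u1 * p.2 - p.1 * v1) ^ 2 + (p.1 * v0 - u0 * p.2) ^ 2)) * t ^ 2 ≤ Fv / 4 := by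
      rw [show (1 / 8 : ℝ) * ((4 / ((1800 * (L : ℝ) ^ 6) * ((1 + p.1 ^ 2) * (1 + p.2 ^ 2)))) * ((u1 * p.2 - p.1 * v1) ^ 2 + (p.1 * v0 - u0 * p.2) ^ 2)) * t ^ 2 =
          (1 / 8 : ℝ) * (4 * (t ^ 2 * ((u1 * p.2 - p.1 * v1) ^ 2 + (p.1 * v0 - u0 * p.2) ^ 2))) / ((1800 * (L : ℝ) ^ 6) * ((1 + p.1 ^ 2) * (1 + p.2 ^ 2))) by ring,
        div_le_iff₀ (by positivity)]
      have hD2 : (1 + (p.1 ^ 2 + (t * u0) ^ 2 + (t * u1) ^ 2)) * (1 + (p.2 ^ 2 + (t * v0) ^ 2 + (t * v1) ^ 2)) ≤ 2 * ((1 + p.1 ^ 2) * (1 + p.2 ^ 2)) := by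
        have ha1 : 1 + (p.1 ^ 2 + (t * u0) ^ 2 + (t * u1) ^ 2) ≤ (5 / 4) * (1 + p.1 ^ 2) := by
          have ee : (t * u0) ^ 2 + (t * u1) ^ 2 = t ^ 2 * (u0 ^ 2 + u1 ^ 2) := by ring
          linarith only [hUt4, ee]
        have hb1 : 1 + (p.2 ^ 2 + (t * v0) ^ 2 + (t * v1) ^ 2) ≤ (5 / 4) * (1 + p.2 ^ 2) := by
          have ee : (t * v0) ^ 2 + (t * v1) ^ 2 = t ^ 2 * (v0 ^ 2 + v1 ^ 2) := by ring
          linarith only [hVt4, ee]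
        calc _ ≤ (5 / 4) * (1 + p.1 ^ 2) * ((5 / 4) * (1 + p.2 ^ 2)) := mul_le_mul ha1 hb1 hDv.le (by positivity)
          _ ≤ 2 * ((1 + p.1 ^ 2) * (1 + p.2 ^ 2)) := by nlinarith only [mul_pos hx1 hy1]
      have hmono : 1800 * (L : ℝ) ^ 6 * Fv * ((1 + (p.1 ^ 2 + (t * u0) ^ 2 + (t * u1) ^ 2)) * (1 + (p.2 ^ 2 + (t * v0) ^ 2 + (t * v1) ^ 2))) ≤
          1800 * (L : ℝ) ^ 6 * Fv * (2 * ((1 + p.1 ^ 2) * (1 + p.2 ^ 2))) := mul_le_mul_of_nonneg_left hD2 (mul_nonneg (by positivity) hFnn)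
      have h1r' : 4 * (t ^ 2 * ((u1 * p.2 - p.1 * v1) ^ 2 + (p.1 * v0 - u0 * p.2) ^ 2)) ≤ 1800 * (L : ℝ) ^ 6 * Fv * ((1 + (p.1 ^ 2 + (t * u0) ^ 2 + (t * u1) ^ 2)) * (1 + (p.2 ^ 2 + (t * v0) ^ 2 + (t * v1) ^ 2))) := by
        have ee : (t * u1 * p.2 - p.1 * (t * v1)) ^ 2 + (p.1 * (t * v0) - t * u0 * p.2) ^ 2 = t ^ 2 * ((u1 * p.2 - p.1 * v1) ^ 2 + (p.1 * v0 - u0 * p.2) ^ 2) := by ring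
        rw [ee] at h1r; exact h1r
      linarith only [h1r', hmono]
    -- (z) share
    have hDz : 0 < 1 + ((t * z0) ^ 2 + (t * z1) ^ 2 + (t * z2) ^ 2) := by positivity
    have h1z := (div_le_iff₀ hDz).1 hFz
    have kz : (1 / 8 : ℝ) * ((1 / (1800 * (L : ℝ) ^ 6)) * (z0 ^ 2 + z1 ^ 2 + z2 ^ 2)) * t ^ 2 ≤ Fv / 4 := by
      rw [show (1 / 8 : ℝ) * ((1 / (1800 * (L : ℝ) ^ 6)) * (z0 ^ 2 + z1 ^ 2 + z2 ^ 2)) * t ^ 2 = (1 / 8 : ℝ) * (t ^ 2 * (z0 ^ 2 + z1 ^ 2 + z2 ^ 2)) / (1800 * (L : ℝ) ^ 6) by ring,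
        div_le_iff₀ (by positivity)]
      have hmono : 1800 * (L : ℝ) ^ 6 * Fv * (1 + ((t * z0) ^ 2 + (t * z1) ^ 2 + (t * z2) ^ 2)) ≤ 1800 * (L : ℝ) ^ 6 * Fv * 2 :=
        mul_le_mul_of_nonneg_left (by
          have ee : (t * z0) ^ 2 + (t * z1) ^ 2 + (t * z2) ^ 2 = t ^ 2 * (z0 ^ 2 + z1 ^ 2 + z2 ^ 2) := by ring
          linarith only [hZt, ee]) (mul_nonneg (by positivity) hFnn)
      have h1z' : t ^ 2 * (z0 ^ 2 + z1 ^ 2 + z2 ^ 2) ≤ 1800 * (L : ℝ) ^ 6 * Fv * (1 + ((t * z0) ^ 2 + (t * z1) ^ 2 + (t * z2) ^ 2)) := by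
        have ee : (t * z0) ^ 2 + (t * z1) ^ 2 + (t * z2) ^ 2 = t ^ 2 * (z0 ^ 2 + z1 ^ 2 + z2 ^ 2) := by ring
        nth_rw 1 [ee] at h1z; exact h1z
      linarith only [h1z', hmono]
    -- sum
    have esum : (1 / 8 : ℝ) * ((16 * Real.cos θ ^ 2 * Real.sin θ ^ 2 / ((7200 * (L : ℝ) ^ 6) * (1 + p.1 ^ 2))) * (u0 ^ 2 + u1 ^ 2) + (4 * Real.sin θ ^ 2 / ((1800 * (L : ℝ) ^ 6) * (1 + p.2 ^ 2))) * (v0 ^ 2 + v1 ^ 2) + (4 / ((1800 * (L : ℝ) ^ 6) * ((1 + p.1 ^ 2) * (1 + p.2 ^ 2)))) * ((u1 * p.2 - p.1 * v1) ^ 2 + (p.1 * v0 - u0 * p.2) ^ 2) + (1 / (1800 * (L : ℝ) ^ 6)) * (z0 ^ 2 + z1 ^ 2 + z2 ^ 2)) * t ^ 2 =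
        (1 / 8 : ℝ) * ((16 * Real.cos θ ^ 2 * Real.sin θ ^ 2 / ((7200 * (L : ℝ) ^ 6) * (1 + p.1 ^ 2))) * (u0 ^ 2 + u1 ^ 2)) * t ^ 2 + (1 / 8 : ℝ) * ((4 * Real.sin θ ^ 2 / ((1800 * (L : ℝ) ^ 6) * (1 + p.2 ^ 2))) * (v0 ^ 2 + v1 ^ 2)) * t ^ 2 + (1 / 8 : ℝ) * ((4 / ((1800 * (L : ℝ) ^ 6) * ((1 + p.1 ^ 2) * (1 + p.2 ^ 2)))) * ((u1 * p.2 - p.1 * v1) ^ 2 + (p.1 * v0 - u0 * p.2) ^ 2)) * t ^ 2 + (1 / 8 : ℝ) * ((1 / (1800 * (L : ℝ) ^ 6)) * (z0 ^ 2 + z1 ^ 2 + z2 ^ 2)) * t ^ 2 := by ring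
    rw [esum]
    linarith only [ku, kv, kr, kz]
  -- the Hessian transfer
  have hH := hessianForm_le_of_le_near hFc hgc hρ0 hle (by
    have h1 := hg0
    have h2 := hF0
    beta_reduce at h1 h2 ⊢
    rw [h1, h2])
  have hq := hessianForm_eq_of_sq_line hgc hlineg
  have hfib : fibQ (angUnit θ) ε p y = iteratedFDeriv ℝ 2 (fun η : GnoCoord L => gnoDeficit z₀ (fun _ => 1) (angUnit θ) ε η) (gnoBase p.1 p.2) (fun _ => gnoFibreEmb y) := by
    have e := Literature.Analysis.Calculus.iteratedDeriv_lineRestriction (n := 2) hFc (gnoBase p.1 p.2) (gnoFibreEmb y) 0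
    rw [zero_smul, add_zero] at e
    unfold fibQ
    exact e
  have e2 : (1 / 4 : ℝ) * ((16 * Real.cos θ ^ 2 * Real.sin θ ^ 2 / ((7200 * (L : ℝ) ^ 6) * (1 + p.1 ^ 2))) * (y (Sum.inl (Sum.inl 0)) ^ 2 + y (Sum.inl (Sum.inl 1)) ^ 2) + (4 * Real.sin θ ^ 2 / ((1800 * (L : ℝ) ^ 6) * (1 + p.2 ^ 2))) * (y (Sum.inl (Sum.inr 0)) ^ 2 + y (Sum.inl (Sum.inr 1)) ^ 2) + (4 / ((1800 * (L : ℝ) ^ 6) * ((1 + p.1 ^ 2) * (1 + p.2 ^ 2)))) * ((y (Sum.inl (Sum.inl 1)) * p.2 - p.1 * y (Sum.inl (Sum.inr 1))) ^ 2 + (p.1 * y (Sum.inl (Sum.inr 0)) - y (Sum.inl (Sum.inl 0)) * p.2) ^ 2) + (1 / (1800 * (L : ℝ) ^ 6)) * (∑ k, y (Sum.inr (Sum.inl k)) ^ 2)) =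
      2 * ((1 / 8 : ℝ) * ((16 * Real.cos θ ^ 2 * Real.sin θ ^ 2 / ((7200 * (L : ℝ) ^ 6) * (1 + p.1 ^ 2))) * (y (Sum.inl (Sum.inl 0)) ^ 2 + y (Sum.inl (Sum.inl 1)) ^ 2) + (4 * Real.sin θ ^ 2 / ((1800 * (L : ℝ) ^ 6) * (1 + p.2 ^ 2))) * (y (Sum.inl (Sum.inr 0)) ^ 2 + y (Sum.inl (Sum.inr 1)) ^ 2) + (4 / ((1800 * (L : ℝ) ^ 6) * ((1 + p.1 ^ 2) * (1 + p.2 ^ 2)))) * ((y (Sum.inl (Sum.inl 1)) * p.2 - p.1 * y (Sum.inl (Sum.inr 1))) ^ 2 + (p.1 * y (Sum.inl (Sum.inr 0)) - y (Sum.inl (Sum.inl 0)) * p.2) ^ 2) + (1 / (1800 * (L : ℝ) ^ 6)) * (∑ k, y (Sum.inr (Sum.inl k)) ^ 2))) := by ring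
  rw [hfib, e2]
  exact hq.symm.le.trans hH

end Summit.QuantumFields.YangMills.Theorems.SwapVirialDeficit.BlowUpRing

end
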